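import Literature.Analysis.SegalBargmann.FockDualPairCompact
import HarnessLib

/-!
# Joint weight spaces of a covariant realisation: closed, spanned by Hermite functions, stable under the commutant

Source followed for the statements: G. B. Folland, *Harmonic Analysis in Phase Space* (1989), Ch. 1 §7 (vii) (the
Hermite functions are an orthonormal basis of `L²(ℝⁿ)` — tree `hermiteBasis`) and Ch. 4 §5, p. 182 ("the spaces
`𝓟_k` … are invariant under `U(n)` … `U(1)` acts on `𝓟_k` by `e^{iθ} ↦ e^{−ikθ}`": the torus of the metaplectic
`U(n)` is diagonalised by the monomials / Hermite functions).  Nothing is cited as a fact; everything below is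
PROVED from Mathlib + the tree.

For a family `ω : H → (E ≃ₗᵢ[ℂ] E)` of unitaries of a Hilbert space, an indexed family of elements
`κ : Θ → H` (a torus, a centre, …) and prescribed eigenvalues `χ : Θ → ℂ`, the **joint weight space** is
`weightSpace ω κ χ = {f | ∀ θ, ω (κ θ) f = χ θ • f}`.

* `weightSpace` is a CLOSED submodule (`isClosed_weightSpace`); any linear map commuting with the `ω (κ θ)`
  preserves it (`mem_weightSpace_of_commute`); for a multiplicative family on a product `A × B` the weight spaces
  of elements of `A × 1` are stable under every `ω (1, b)` (`mem_weightSpace_prod_left`) and those of `1 × B` under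
  every `ω (a, 1)` (`mem_weightSpace_prod_right`); weight spaces of a commuting family are stable under the family
  (`mem_weightSpace_of_mem_comm`) — the archimedean prototypes of `SK_stable` for an index space cut out by weights.
* On `E = L²(ℝ^σ)` with `ω` Heisenberg-covariant (`IsRhoCovariant ι ω`, tree `SchrodingerCompactRigidity`) and
  `ι (κ θ) = diagHom (τ θ)` diagonal, the Hermite function `h_m` has the joint weight
  `hermWeight ω κ τ m θ = vacCoeff ω (κ θ) · torusChar m (τ θ)` (unimodular), and
  **`weightSpace ω κ χ = closure (span {h_m | hermWeight ω κ τ m = χ})`**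
  (`IsRhoCovariant.weightSpace_eq_closure_span_hermite`): `⊇` from `IsRhoCovariant.apply_hermiteL2_of_diag`, `⊆`
  from the Hermite expansion (`hermiteBasis`) — a vector of weight `χ` is orthogonal to every `h_m` of another
  weight (`inner_eq_zero_of_weight_ne`, unitarity).
* Dual pair (`dualPairι` of `FockDualPairCompact`): for a multiplicative covariant realisation `ω` of
  `(U(P)×U(Q)) × (U(R)×U(S))` on `L²(ℝ^{DPIdx})`, the weight spaces of the torus `1 × T_W` are the closed spans of
  the Hermite functions with `vacCoeff ω (1,t) · torusChar m (dpTorus 1 1 γ δ) = χ(t)` (block degrees shifted by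
  the vacuum character; `dualPair_weightSpaceW_eq`), stable under `ω` of the whole first member
  (`dualPair_weightSpaceW_stable_V`) and under the torus of the second (`dualPair_weightSpaceW_stable_torusW`) —
  for a LINE `W` (`R` or `S` empty, the other a point) `T_W = U(W)(ℝ) = U(1)` and this is the full archimedean
  `SK_stable`.

## References

* [Folland1989] G. B. Folland, *Harmonic Analysis in Phase Space*, Princeton UP 1989, §1.7 (vii) p. 47, Ch. 4 §5
  p. 182, Prop. (4.39) p. 161.
-/

noncomputable section

open MeasureTheory Complex Matrix Filter
open scoped InnerProductSpace ComplexConjugate Topology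

namespace Literature.Analysis.SegalBargmann

set_option autoImplicit false

/-! ## 1. Joint weight spaces of a family of unitaries -/

section General

variable {E : Type*} [NormedAddCommGroup E] [InnerProductSpace ℂ E] {H : Type*} {Θ : Type*}

/-- **Joint weight space** `{f | ∀ θ, ω (κ θ) f = χ θ • f}` of a family of unitaries along an indexed family of
group elements. [folklore] -/
def weightSpace (ω : H → (E ≃ₗᵢ[ℂ] E)) (κ : Θ → H) (χ : Θ → ℂ) : Submodule ℂ E where
  carrier := {f | ∀ θ, ω (κ θ) f = χ θ • f}
  zero_mem' := fun θ => by simp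
  add_mem' := fun {f g} hf hg θ => by rw [map_add, hf θ, hg θ, smul_add]
  smul_mem' := fun c {f} hf θ => by
    change ω (κ θ) (c • f) = χ θ • (c • f)
    rw [LinearIsometryEquiv.map_smul, hf θ, smul_comm]

/-- Membership in the joint weight space. [folklore] -/
theorem mem_weightSpace {ω : H → (E ≃ₗᵢ[ℂ] E)} {κ : Θ → H} {χ : Θ → ℂ} {f : E} :
    f ∈ weightSpace ω κ χ ↔ ∀ θ, ω (κ θ) f = χ θ • f := Iff.rfl

/-- **Joint weight spaces are closed.** [folklore] -/
theorem isClosed_weightSpace (ω : H → (E ≃ₗᵢ[ℂ] E)) (κ : Θ → H) (χ : Θ → ℂ) :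
    IsClosed (weightSpace ω κ χ : Set E) := by
  have : (weightSpace ω κ χ : Set E) = ⋂ θ, {f : E | ω (κ θ) f = χ θ • f} := by
    ext f; simp [mem_weightSpace]
  rw [this]
  exact isClosed_iInter fun θ => isClosed_eq (ω (κ θ)).continuous (continuous_const_smul (χ θ))

/-- The closure of a joint weight space is itself. [folklore] -/
theorem topologicalClosure_weightSpace (ω : H → (E ≃ₗᵢ[ℂ] E)) (κ : Θ → H) (χ : Θ → ℂ) :
    (weightSpace ω κ χ).topologicalClosure = weightSpace ω κ χ :=
  le_antisymm ((weightSpace ω κ χ).topologicalClosure_minimal le_rfl (isClosed_weightSpace ω κ χ))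
    (Submodule.le_topologicalClosure _)

/-- **Stability under the commutant**: a `ℂ`-linear map commuting with every `ω (κ θ)` preserves the joint weight
space. [folklore] -/
theorem mem_weightSpace_of_commute {ω : H → (E ≃ₗᵢ[ℂ] E)} {κ : Θ → H} {χ : Θ → ℂ} (B : E →ₗ[ℂ] E)
    (hB : ∀ θ f, ω (κ θ) (B f) = B (ω (κ θ) f)) {f : E} (hf : f ∈ weightSpace ω κ χ) :
    B f ∈ weightSpace ω κ χ := fun θ => by
  rw [hB θ, hf θ, map_smul]

/-- For a multiplicative family on a product, `ω (a, 1)` and `ω (1, b)` commute. [folklore] -/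
theorem apply_inl_apply_inr_comm {A B : Type*} [MulOneClass A] [MulOneClass B] (ω : A × B → (E ≃ₗᵢ[ℂ] E))
    (hmul : ∀ x y f, ω (x * y) f = ω x (ω y f)) (a : A) (b : B) (f : E) :
    ω (a, 1) (ω (1, b) f) = ω (1, b) (ω (a, 1) f) := by
  rw [← hmul, ← hmul, Prod.mk_mul_mk, Prod.mk_mul_mk, one_mul, mul_one, one_mul, mul_one]

/-- **`SK_stable` prototype (weights of the first member)**: for a multiplicative family `ω` on `A × B`, the joint
weight spaces of elements of `A × 1` are stable under every `ω (1, b)`. [folklore] -/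
theorem mem_weightSpace_prod_left {A B : Type*} [MulOneClass A] [MulOneClass B]
    (ω : A × B → (E ≃ₗᵢ[ℂ] E)) (hmul : ∀ x y f, ω (x * y) f = ω x (ω y f)) (κA : Θ → A) (χ : Θ → ℂ)
    (b : B) {f : E} (hf : f ∈ weightSpace ω (fun θ => (κA θ, (1 : B))) χ) :
    ω (1, b) f ∈ weightSpace ω (fun θ => (κA θ, (1 : B))) χ :=
  mem_weightSpace_of_commute (ω (1, b)).toLinearEquiv.toLinearMap
    (fun θ g => apply_inl_apply_inr_comm ω hmul (κA θ) b g) hf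

/-- **`SK_stable` prototype (weights of the second member)**: the joint weight spaces of elements of `1 × B` are
stable under every `ω (a, 1)`. [folklore] -/
theorem mem_weightSpace_prod_right {A B : Type*} [MulOneClass A] [MulOneClass B]
    (ω : A × B → (E ≃ₗᵢ[ℂ] E)) (hmul : ∀ x y f, ω (x * y) f = ω x (ω y f)) (κB : Θ → B) (χ : Θ → ℂ)
    (a : A) {f : E} (hf : f ∈ weightSpace ω (fun θ => ((1 : A), κB θ)) χ) :
    ω (a, 1) f ∈ weightSpace ω (fun θ => ((1 : A), κB θ)) χ :=
  mem_weightSpace_of_commute (ω (a, 1)).toLinearEquiv.toLinearMap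
    (fun θ g => (apply_inl_apply_inr_comm ω hmul a (κB θ) g).symm) hf

/-- Weight spaces of a family of pairwise COMMUTING elements are stable under the family (e.g. the
`U(1) = U(W)`-weight spaces under `U(W)` for a line `W`). [folklore] -/
theorem mem_weightSpace_of_mem_comm {ω : H → (E ≃ₗᵢ[ℂ] E)} [Mul H] (hmul : ∀ x y f, ω (x * y) f = ω x (ω y f))
    {κ : Θ → H} (hcomm : ∀ θ θ', κ θ * κ θ' = κ θ' * κ θ) {χ : Θ → ℂ} (θ' : Θ) {f : E}
    (hf : f ∈ weightSpace ω κ χ) : ω (κ θ') f ∈ weightSpace ω κ χ :=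
  mem_weightSpace_of_commute (ω (κ θ')).toLinearEquiv.toLinearMap
    (fun θ g => by
      change ω (κ θ) (ω (κ θ') g) = ω (κ θ') (ω (κ θ) g)
      rw [← hmul, ← hmul, hcomm]) hf

/-- A weight vector is orthogonal to a weight vector of a different UNIMODULAR weight for the same unitary.
[folklore] -/
theorem inner_eq_zero_of_weight_ne (U : E ≃ₗᵢ[ℂ] E) {f g : E} {c d : ℂ} (hg : U g = c • g) (hf : U f = d • f)
    (hc : ‖c‖ = 1) (hcd : c ≠ d) : ⟪g, f⟫_ℂ = 0 := by
  have key : ⟪U g, U f⟫_ℂ = ⟪g, f⟫_ℂ := U.inner_map_map g f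
  rw [hg, hf, inner_smul_left, inner_smul_right, ← mul_assoc] at key
  have hcc : conj c * c = 1 := by
    rw [← Complex.normSq_eq_conj_mul_self, Complex.normSq_eq_norm_sq, hc]; norm_num
  by_contra hne
  apply hcd
  have h1 : conj c * d = 1 := mul_right_cancel₀ hne (key.trans (one_mul _).symm)
  calc c = c * (conj c * d) := by rw [h1, mul_one]
    _ = (conj c * c) * d := by ring
    _ = d := by rw [hcc, one_mul]

end General

/-! ## 2. Hermite description on `L²(ℝ^σ)` for a covariant family along a diagonal torus -/

section Hermite

variable {σ : Type*} [Fintype σ] [DecidableEq σ] {H : Type*} {Θ : Type*}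

local notation "L2R" σ => Lp ℂ 2 (volume : Measure (σ → ℝ))

omit [DecidableEq σ] in
/-- `‖torusChar m t‖ = 1`. [folklore] -/
theorem norm_torusChar (m : σ →₀ ℕ) (t : σ → Circle) : ‖torusChar m t‖ = 1 := by
  rw [torusChar, norm_prod]
  exact Finset.prod_eq_one fun l _ => by rw [norm_pow, Complex.norm_conj, Circle.norm_coe, one_pow]

/-- **The joint weight of the Hermite function `h_m`** along `κ`, for a covariant family whose `ι ∘ κ` is the
diagonal torus `diagHom ∘ τ`: vacuum coefficient times polynomial weight. [folklore] -/
def hermWeight (ω : H → ((L2R σ) ≃ₗᵢ[ℂ] (L2R σ))) (κ : Θ → H) (τ : Θ → (σ → Circle)) (m : σ →₀ ℕ) (θ : Θ) :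
    ℂ :=
  vacCoeff ω (κ θ) * torusChar m (τ θ)

/-- `h_m` is a joint weight vector with weight `hermWeight ω κ τ m`. [folklore] -/
theorem IsRhoCovariant.apply_hermiteL2_eq_hermWeight {ι : H → Matrix.unitaryGroup σ ℂ}
    {ω : H → ((L2R σ) ≃ₗᵢ[ℂ] (L2R σ))} (hω : IsRhoCovariant ι ω) {κ : Θ → H} {τ : Θ → (σ → Circle)}
    (hτ : ∀ θ, ι (κ θ) = diagHom (τ θ)) (m : σ →₀ ℕ) (θ : Θ) :
    ω (κ θ) (hermiteL2 m) = hermWeight ω κ τ m θ • hermiteL2 m :=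
  hω.apply_hermiteL2_of_diag (hτ θ) m

/-- The Hermite weights are unimodular. [folklore] -/
theorem IsRhoCovariant.norm_hermWeight {ι : H → Matrix.unitaryGroup σ ℂ}
    {ω : H → ((L2R σ) ≃ₗᵢ[ℂ] (L2R σ))} (hω : IsRhoCovariant ι ω) (κ : Θ → H) (τ : Θ → (σ → Circle))
    (m : σ →₀ ℕ) (θ : Θ) : ‖hermWeight ω κ τ m θ‖ = 1 := by
  rw [hermWeight, norm_mul, hω.norm_vacCoeff, norm_torusChar, one_mul]

/-- `h_m ≠ 0` in `L²(ℝ^σ)`. [folklore] -/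
theorem hermiteL2_ne_zero' (m : σ →₀ ℕ) : (hermiteL2 m : L2R σ) ≠ 0 := by
  intro h0
  have := (orthonormal_hermiteL2 (σ := σ)).1 m
  rw [h0, norm_zero] at this
  exact zero_ne_one this

/-- **`h_m` lies in the weight space of `χ` iff its weights are `χ`.** [folklore] -/
theorem IsRhoCovariant.hermiteL2_mem_weightSpace_iff {ι : H → Matrix.unitaryGroup σ ℂ}
    {ω : H → ((L2R σ) ≃ₗᵢ[ℂ] (L2R σ))} (hω : IsRhoCovariant ι ω) {κ : Θ → H} {τ : Θ → (σ → Circle)}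
    (hτ : ∀ θ, ι (κ θ) = diagHom (τ θ)) (χ : Θ → ℂ) (m : σ →₀ ℕ) :
    hermiteL2 m ∈ weightSpace ω κ χ ↔ ∀ θ, hermWeight ω κ τ m θ = χ θ := by
  refine ⟨fun hm θ => ?_, fun hm θ => by rw [hω.apply_hermiteL2_eq_hermWeight hτ, hm θ]⟩
  have h1 := hm θ
  rw [hω.apply_hermiteL2_eq_hermWeight hτ] at h1
  have h2 : (hermWeight ω κ τ m θ - χ θ) • (hermiteL2 m : L2R σ) = 0 := by rw [sub_smul, h1, sub_self]
  exact sub_eq_zero.mp ((smul_eq_zero.mp h2).resolve_right (hermiteL2_ne_zero' m))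

/-- A vector of weight `χ` is orthogonal to every Hermite function with a different weight. [folklore] -/
theorem IsRhoCovariant.inner_hermiteL2_eq_zero_of_weight_ne {ι : H → Matrix.unitaryGroup σ ℂ}
    {ω : H → ((L2R σ) ≃ₗᵢ[ℂ] (L2R σ))} (hω : IsRhoCovariant ι ω) {κ : Θ → H} {τ : Θ → (σ → Circle)}
    (hτ : ∀ θ, ι (κ θ) = diagHom (τ θ)) {χ : Θ → ℂ} {f : L2R σ} (hf : f ∈ weightSpace ω κ χ) {m : σ →₀ ℕ}
    {θ : Θ} (hne : hermWeight ω κ τ m θ ≠ χ θ) : ⟪(hermiteL2 m : L2R σ), f⟫_ℂ = 0 :=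
  inner_eq_zero_of_weight_ne (ω (κ θ)) (hω.apply_hermiteL2_eq_hermWeight hτ m θ) (hf θ)
    (hω.norm_hermWeight κ τ m θ) hne

/-- The Hermite functions of joint weight `χ`. [folklore] -/
def hermOfWeight (ω : H → ((L2R σ) ≃ₗᵢ[ℂ] (L2R σ))) (κ : Θ → H) (τ : Θ → (σ → Circle)) (χ : Θ → ℂ) :
    Set (L2R σ) :=
  {g | ∃ m : σ →₀ ℕ, (∀ θ, hermWeight ω κ τ m θ = χ θ) ∧ g = hermiteL2 m}

/-- **Joint weight spaces are closed spans of Hermite functions**: for a covariant family whose `ι ∘ κ` is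
diagonal, `weightSpace ω κ χ = closure (span {h_m | hermWeight ω κ τ m = χ})`. [folklore] -/
theorem IsRhoCovariant.weightSpace_eq_closure_span_hermite {ι : H → Matrix.unitaryGroup σ ℂ}
    {ω : H → ((L2R σ) ≃ₗᵢ[ℂ] (L2R σ))} (hω : IsRhoCovariant ι ω) {κ : Θ → H} {τ : Θ → (σ → Circle)}
    (hτ : ∀ θ, ι (κ θ) = diagHom (τ θ)) (χ : Θ → ℂ) :
    weightSpace ω κ χ = (Submodule.span ℂ (hermOfWeight ω κ τ χ)).topologicalClosure := by
  apply le_antisymm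
  · -- `⊆`: Hermite expansion; coefficients outside the weight pattern vanish
    intro f hf
    have hsum := (hermiteBasis (σ := σ)).hasSum_repr f
    simp_rw [HilbertBasis.repr_apply_apply, hermiteBasis_apply] at hsum
    rw [← SetLike.mem_coe, Submodule.topologicalClosure_coe]
    refine mem_closure_of_tendsto hsum (Filter.Eventually.of_forall fun F => ?_)
    refine SetLike.mem_coe.mpr (Submodule.sum_mem _ fun m _ => ?_)
    by_cases hm : ∀ θ, hermWeight ω κ τ m θ = χ θ
    · exact Submodule.smul_mem _ _ (Submodule.subset_span ⟨m, hm, rfl⟩)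
    · push Not at hm
      obtain ⟨θ, hne⟩ := hm
      rw [hω.inner_hermiteL2_eq_zero_of_weight_ne hτ hf hne, zero_smul]
      exact Submodule.zero_mem _
  · -- `⊇`: a closed submodule containing the generators
    refine Submodule.topologicalClosure_minimal _ (Submodule.span_le.mpr ?_) (isClosed_weightSpace ω κ χ)
    rintro g ⟨m, hm, rfl⟩
    exact (hω.hermiteL2_mem_weightSpace_iff hτ χ m).mpr hm

end Hermite

/-! ## 3. The dual pair: weight spaces of the torus of the second member -/

section DualPair

variable {P Q R S : Type*} [Fintype P] [DecidableEq P] [Fintype Q] [DecidableEq Q] [Fintype R] [DecidableEq R]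
  [Fintype S] [DecidableEq S]

local notation "L2R" σ => Lp ℂ 2 (volume : Measure (σ → ℝ))

/-- **The torus `1 × T_W` of the second member** as an indexed family: `(γ, δ) ↦ ((1,1), (diag γ, diag δ))`.
[folklore] -/
def κW (θ : (R → Circle) × (S → Circle)) : DPK P Q R S := ((1, 1), (diagHom θ.1, diagHom θ.2))

/-- Its torus datum on `DPIdx`: `dpTorus 1 1 γ δ`. [folklore] -/
def τW (θ : (R → Circle) × (S → Circle)) : DPIdx P Q R S → Circle :=
  dpTorus (fun _ : P => (1 : Circle)) (fun _ : Q => (1 : Circle)) θ.1 θ.2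

/-- On `1 × T_W` the block datum is the diagonal torus `diagHom ∘ τW`. [folklore] -/
theorem dualPairι_κW (θ : (R → Circle) × (S → Circle)) :
    dualPairι (κW (P := P) (Q := Q) θ) = diagHom (τW (P := P) (Q := Q) θ) := by
  have h := dualPairι_diagHom (fun _ : P => (1 : Circle)) (fun _ : Q => (1 : Circle)) θ.1 θ.2
  rwa [show diagHom (fun _ : P => (1 : Circle)) = 1 from map_one diagHom,
    show diagHom (fun _ : Q => (1 : Circle)) = 1 from map_one diagHom] at h

/-- The torus elements commute. [folklore] -/
theorem κW_comm (θ θ' : (R → Circle) × (S → Circle)) :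
    κW (P := P) (Q := Q) θ * κW θ' = κW θ' * κW θ := by
  simp only [κW, Prod.mk_mul_mk, mul_one, ← map_mul, mul_comm]

/-- **The Hermite weights along `1 × T_W`**: vacuum coefficient times `γ, δ`-powers by block degrees — `+` on the
same-sign blocks `P×R`, `Q×S`, `−` (conjugate) on the mixed blocks `P×S`, `Q×R`. [folklore] -/
theorem hermWeight_κW (ω : DPK P Q R S → ((L2R (DPIdx P Q R S)) ≃ₗᵢ[ℂ] (L2R (DPIdx P Q R S))))
    (m : DPIdx P Q R S →₀ ℕ) (θ : (R → Circle) × (S → Circle)) :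
    hermWeight ω κW τW m θ =
      vacCoeff ω (κW θ) *
        (((∏ pr : P × R, (((θ.1 pr.2 : Circle)) : ℂ) ^ m (Sum.inl (Sum.inl pr))) *
            ∏ qs : Q × S, (((θ.2 qs.2 : Circle)) : ℂ) ^ m (Sum.inl (Sum.inr qs))) *
          ((∏ ps : P × S, conj (((θ.2 ps.2 : Circle)) : ℂ) ^ m (Sum.inr (Sum.inl ps))) *
            ∏ qr : Q × R, conj (((θ.1 qr.2 : Circle)) : ℂ) ^ m (Sum.inr (Sum.inr qr)))) := by
  rw [hermWeight, τW, torusChar_dpTorus]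
  simp only [one_mul]

/-- **Weight spaces of `1 × T_W` are closed spans of Hermite functions with prescribed shifted block weights.**
[folklore] -/
theorem IsRhoCovariant.dualPair_weightSpaceW_eq
    {ω : DPK P Q R S → ((L2R (DPIdx P Q R S)) ≃ₗᵢ[ℂ] (L2R (DPIdx P Q R S)))}
    (hω : IsRhoCovariant (fun k => dualPairι k) ω) (χ : (R → Circle) × (S → Circle) → ℂ) :
    weightSpace ω κW χ = (Submodule.span ℂ (hermOfWeight ω κW τW χ)).topologicalClosure :=
  hω.weightSpace_eq_closure_span_hermite dualPairι_κW χ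

/-- **Stability under the whole first member** `U(P) × U(Q)` (it commutes with `1 × T_W`). [folklore] -/
theorem dualPair_weightSpaceW_stable_V
    {ω : DPK P Q R S → ((L2R (DPIdx P Q R S)) ≃ₗᵢ[ℂ] (L2R (DPIdx P Q R S)))}
    (hmul : ∀ x y f, ω (x * y) f = ω x (ω y f)) (χ : (R → Circle) × (S → Circle) → ℂ)
    (kV : Matrix.unitaryGroup P ℂ × Matrix.unitaryGroup Q ℂ) {f : L2R (DPIdx P Q R S)}
    (hf : f ∈ weightSpace ω κW χ) : ω (kV, 1) f ∈ weightSpace ω κW χ :=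
  mem_weightSpace_prod_right ω hmul (fun θ : (R → Circle) × (S → Circle) => (diagHom θ.1, diagHom θ.2)) χ kV hf

/-- **Stability under the torus `1 × T_W` itself** (for a line `W`, `T_W = U(W)(ℝ) = U(1)`: the full archimedean
`SK_stable`). [folklore] -/
theorem dualPair_weightSpaceW_stable_torusW
    {ω : DPK P Q R S → ((L2R (DPIdx P Q R S)) ≃ₗᵢ[ℂ] (L2R (DPIdx P Q R S)))}
    (hmul : ∀ x y f, ω (x * y) f = ω x (ω y f)) (χ : (R → Circle) × (S → Circle) → ℂ)
    (θ' : (R → Circle) × (S → Circle)) {f : L2R (DPIdx P Q R S)} (hf : f ∈ weightSpace ω κW χ) :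
    ω (κW θ') f ∈ weightSpace ω κW χ :=
  mem_weightSpace_of_mem_comm hmul κW_comm θ' hf

end DualPair

end Literature.Analysis.SegalBargmann
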